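import Summits.CriticalPhenomena.PercolationContinuityZ3.Theorems.Transplant.SkeletonRankDefs
import Summits.CriticalPhenomena.PercolationContinuityZ3.Theorems.Transplant.PlanarSkeletonBoxProd
import HarnessLib

/-!
# Cartesian products inherit skeletons of every rank: `Skeleton m Y → Skeleton m (X □ Y)` for quasi-transitive `X`

builds on p205010 (kernel theorem, internal audit signed; external expert review pending) — nothing in this file uses p205010.
Lane `prim-bschramm`, seat `prim-bschramm-p4` (gen 3; class map, memo `P4-GENERAL.md` §11.4–11.6), helper file
(`--supports stmt-CriticalPhenomena-4575`).  Rank-`m` twin of `PlanarSkeleton.boxProdLeft` (p220983): `Skeleton.boxProdLeft`, its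
cylinders `univ ×ˢ cyl` (`Skeleton.cyl_boxProdLeft`), and the rank-`m` conditional closure for products from the rank-`m` drop node given
input Φ2 on the product (`continuity_boxProd_of_dropNodeRank`).  With the product slab–quotient criterion (p221269) this is the schema
"`X □ Y` is node-only whenever `Y` is" for every rank.
[cite: BenjaminiSchramm1996, §2 and Conj. 4] [cite: KozmaNitzan2024, §4 p. 15]
-/

noncomputable section

namespace Summit.CriticalPhenomena.PercolationContinuityZ3.Theorems.Transplant

open MeasureTheory Literature.Probability.Percolation Literature.Probability.LatticeModels
open Literature.Probability.Percolation.GM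
open Literature.Barriers.CriticalPhenomena (IsQuasiTransitive IsGraphAmenable)

variable {W U : Type} {m : ℕ}

/-- Along an edge of `X □ Y` the rank-`m` skeleton coordinate of the `Y`-component moves by at most one. [folklore] -/
theorem Skeleton.abs_phi_snd_sub_le_one (X : SimpleGraph W) {Y : SimpleGraph U} (Φ : Skeleton m Y) {u v : W × U}
    (h : (X □ Y).Adj u v) (i : Fin m) : |Φ.φ u.2 i - Φ.φ v.2 i| ≤ 1 := by
  rcases SimpleGraph.boxProd_adj.1 h with ⟨_, h2⟩ | ⟨h2, _⟩
  · rw [h2, sub_self, abs_zero]; exact zero_le_one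
  · exact Φ.lip h2 i

/-- **The product skeleton of rank `m`**: `φ = Φ.φ ∘ Prod.snd`, base vertices `V₀ × Φ.types`, frames and point group the products
`boxProdIso`. [cite: BenjaminiSchramm1996, §2 (almost transitive graphs)] -/
def Skeleton.boxProdLeft (X : SimpleGraph W) (hq : IsQuasiTransitive X) {Y : SimpleGraph U} (Φ : Skeleton m Y) :
    Skeleton m (X □ Y) where
  φ := fun v => Φ.φ v.2
  lip := fun _ _ h i => Skeleton.abs_phi_snd_sub_le_one X Φ h i
  types := (Classical.choose hq) ×ˢ Φ.types
  frame := by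
    classical
    intro v
    obtain ⟨γ, hγ⟩ := Classical.choose_spec hq v.1
    obtain ⟨t, ht, α, hαt, hα⟩ := Φ.frame v.2
    refine ⟨(γ v.1, t), Finset.mem_product.2 ⟨hγ, ht⟩, boxProdIso γ.symm α, ?_, fun w => ?_⟩
    · rw [boxProdIso_apply]; simp [hαt]
    · rw [boxProdIso_apply]; simp [hα]
  point := by
    classical
    intro t ht g
    obtain ⟨α, hαt, hα⟩ := Φ.point t.2 (Finset.mem_product.1 ht).2 g
    refine ⟨boxProdIso (SimpleGraph.Iso.refl (G := X)) α, ?_, fun w => ?_⟩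
    · rw [boxProdIso_apply]; ext <;> simp [hαt]
    · rw [boxProdIso_apply]; simp [hα]

/-- Base vertices of the product skeleton. [folklore] -/
theorem Skeleton.mem_types_boxProdLeft (X : SimpleGraph W) (hq : IsQuasiTransitive X) {Y : SimpleGraph U} (Φ : Skeleton m Y)
    (t : W × U) : t ∈ (Φ.boxProdLeft X hq).types ↔ t.1 ∈ Classical.choose hq ∧ t.2 ∈ Φ.types :=
  Finset.mem_product

/-- **The cylinders of the product skeleton are `X × (cylinder of Φ)`.** [folklore] -/
theorem Skeleton.cyl_boxProdLeft (X : SimpleGraph W) (hq : IsQuasiTransitive X) {Y : SimpleGraph U} (Φ : Skeleton m Y) (t : W × U)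
    (ℓ : ℕ) : (Φ.boxProdLeft X hq).cyl t ℓ = Set.univ ×ˢ Φ.cyl t.2 ℓ := by
  ext v; simp [Skeleton.cyl, Skeleton.boxProdLeft]

/-- **Rank-`m` products from the rank-`m` drop node**: for `X` connected, locally finite, quasi-transitive of subexponential growth and `Y`
connected, locally finite, quasi-transitive of polynomial growth with a skeleton of rank `m ≥ 2`, input Φ2 of the product skeleton at
`p_c` gives `θ_t(p_c) = 0` at every base vertex — conditional on `SamePDropOfSkeletonRank` (not claimed).
[cite: BenjaminiSchramm1996, Conj. 4] [cite: LyonsPeres2016, §6.1, Thm. 7.6] -/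
theorem continuity_boxProd_of_dropNodeRank (hD : SamePDropOfSkeletonRank) (hm : 2 ≤ m) [DecidableEq W] [DecidableEq U]
    (X : SimpleGraph W) [X.LocallyFinite] (Y : SimpleGraph U) [Y.LocallyFinite] [Nonempty U] (hcX : X.Connected)
    (hqX : IsQuasiTransitive X) (hgX : ¬ Literature.Barriers.CriticalPhenomena.HasExponentialGrowth X) (hcY : Y.Connected)
    (hqY : IsQuasiTransitive Y) (D : ℕ) (hY : ∀ (y : U) (n : ℕ), Literature.Barriers.CriticalPhenomena.ballVolume Y y n ≤ (2 * n + 1) ^ D)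
    (Φ : Skeleton m Y) (t : W × U) (ht : t ∈ (Φ.boxProdLeft X hqX).types)
    (hC : (Φ.boxProdLeft X hqX).CylSubcritical (criticalProbIOf (X □ Y) t)) : theta (X □ Y) t (criticalProbIOf (X □ Y) t) = 0 :=
  continuity_of_skeletonRank_drop_amenable hD hm (X □ Y) (Φ.boxProdLeft X hqX) (hcX.boxProd hcY) (isQuasiTransitive_boxProd hqX hqY)
    (isGraphAmenable_boxProd_of_polyGrowth X Y hqX hqY D hY hgX) t ht hC

end Summit.CriticalPhenomena.PercolationContinuityZ3.Theorems.Transplant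

end
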